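import Literature.AlgebraicGeometry.Frobenioids.Prop25Sub
import Literature.AlgebraicGeometry.Frobenioids.ElementaryIsomorphisms
import HarnessLib

/-!
# [FrdI] Proposition 2.5 (iii), sub-DAG row P25-L03 — the characteristic splitting at an arbitrary
# object (through an isotropic hull): discharge of `FrdI.P25.SplittingAtAnyObject`

Mochizuki, *The geometry of Frobenioids I: the general theory*, Kyushu J. Math. **62** (2008)
293–400, §2, proof of Proposition 2.5 (iii), p. 49 ll. 32–37 [cite: MochizukiFrdI2008, Prop. 2.5(iii) p.49]:
"by applying the characteristic splitting `O^×(A) × τ(A) ⥲ O^▷(A)` [which applies even if `A` is not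
isotropic — cf. Definition 2.3, (a), (b)] to `β ∈ O^▷(A)`, we obtain a factorization `β = β₀ · β₁`
[where `β₀ ∈ O^×(A)`, `β₁ ∈ τ(A)`]".
PROOF-ONLY companion of `Prop25Sub.lean` (row P25-L03 `SplittingAtAnyObject`, holder/typer
abc-iut-L1-t2).  For an isotropic hull `h : A → A^istr`: transport `β` to `A^istr` (universal property
of the hull), split there (Def. 2.3 (a), `CharacteristicSplitting.splitMap_surjective`), pull the
`τ`-component back along `h` (Def. 2.3 (b), field `hull`), and recover the unit by "faithfulness up to
units" (Def. 1.3 (vi)) — the two co-angular pre-steps `β`, `β₁` of `A` are base- and metrically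
equivalent because `h` is an isometric pre-step.  Uniqueness: the `τ`-components have the same zero
divisor, hence differ by a unit (Def. 1.3 (vi)), hence coincide by Def. 2.3 (a)
(`splitMap_injective`); then `h` is a monomorphism (Def. 1.3 (v)(a)) and `β₁` an epimorphism.
No new definitions.
-/

namespace Literature.AlgebraicGeometry.Frobenioids

open CategoryTheory Opposite

namespace FrdI.P25

open PreFrobenioid

universe w v v' u u'

variable {D : Type u} [Category.{v} D] {Φ : Dᵒᵖ ⥤ CommMonCat.{w}}
  {C : Type u'} [Category.{v'} C] {F : C ⥤ ElemFrobenioid Φ}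

/-- Along an isometric pre-step `h : A → A'`, an endomorphism `x ∈ O^▷(A)` and its transport `y`
(`h ≫ y = x ≫ h`) have zero divisors related by `Div x = (Base h)^* (Div y)` (Remark 1.1.1).
[cite: MochizukiFrdI2008, Rem. 1.1.1 p.20] -/
theorem div_eq_pull_of_transport {A A' : C} {h : A ⟶ A'} (hhiso : IsIsometry F h)
    (hhlin : IsLinear F h) {x : A ⟶ A} {y : A' ⟶ A'} (hxy : h ≫ y = x ≫ h) : Div F x = pull Φ (Base F h) (Div F y) := by
  have e := congrArg (Div F) hxy
  rw [div_comp, div_comp, show Div F h = 1 from hhiso, one_pow, mul_one, map_one, one_mul,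
    show degFr F h = 1 from hhlin, PNat.one_coe, pow_one] at e
  exact e.symm

/-- Post-composing an endomorphism with a unit does not change the zero divisor.
[cite: MochizukiFrdI2008, Rem. 1.1.1 p.20] -/
theorem div_comp_unit (hP : IsPreFrobenioid Φ F) {A : C} (b : A ⟶ A) (u : Aut A) :
    Div F (b ≫ u.hom) = Div F b := by
  rw [div_comp, show Div F u.hom = 1 from isIsometry_of_isIso F hP u.hom, map_one, one_mul,
    show degFr F u.hom = 1 from isLinear_of_isIso F u.hom, PNat.one_coe, pow_one]

/-- Two elements of `τ(A')` (`A'` isotropic) with the same zero divisor are equal (Def. 1.3 (vi) +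
Def. 2.3 (a)). [cite: MochizukiFrdI2008, Def. 2.3 p.47] -/
theorem tau_eq_of_div_eq (hF : IsFrobenioid F) (τ : CharacteristicSplitting F) {A' : C}
    (hA' : IsIsotropic F A') {t₁ t₂ : A' ⟶ A'} (ht₁ : (t₁ : End A') ∈ τ.τ A')
    (ht₂ : (t₂ : End A') ∈ τ.τ A') (hdiv : Div F t₁ = Div F t₂) : t₁ = t₂ := by
  have h₁ : (t₁ : End A') ∈ endSubmonoid F A' := τ.τ_le hA' ht₁
  have h₂ : (t₂ : End A') ∈ endSubmonoid F A' := τ.τ_le hA' ht₂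
  obtain ⟨w, hw, hwt⟩ := hF.vi t₁ t₂
    ⟨isCoAngular_endo F hF _, isPreStep_of_mem_endSubmonoid F ⟨t₁, h₁⟩⟩
    ⟨isCoAngular_endo F hF _, isPreStep_of_mem_endSubmonoid F ⟨t₂, h₂⟩⟩
    (h₁.1.trans h₂.1.symm) hdiv
  -- `t₂ ≫ w = t₁`: the splittings `(w, t₂)` and `(1, t₁)` agree, so `t₂ = t₁` by Def. 2.3 (a)
  have e : τ.splitMap hA' (⟨w, hw⟩, ⟨t₂, ht₂⟩) = τ.splitMap hA' (1, ⟨t₁, ht₁⟩) := by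
    apply Subtype.ext
    change t₂ ≫ w.hom = t₁ ≫ (1 : Aut A').hom
    rw [hwt]
    exact (Category.comp_id _).symm
  have := congrArg (fun p => (p.2.1 : End A')) (τ.splitMap_injective hF hA' e)
  exact this.symm

/-- **Row P25-L03 `SplittingAtAnyObject` DISCHARGED**: the characteristic splitting at an arbitrary
object, read through an isotropic hull. [cite: MochizukiFrdI2008, Prop. 2.5(iii) p.49] -/
theorem splittingAtAnyObject_holds (τ : CharacteristicSplitting F) : SplittingAtAnyObject F τ := by
  intro hS A A' h hh β hβ
  have hF := hS.isFrobenioid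
  have hP := hF.isPreFrobenioid
  obtain ⟨hhiso, hhpre, hA', huniv⟩ := id hh
  haveI : IsIso (Base F h) := hhpre.2
  -- E1/E2: transport `β` to `A'`
  obtain ⟨βt, hβt, -⟩ := huniv (β ≫ h) hA'
  have hβt_base : IsBaseIdentity F βt := by
    have e := congrArg (Base F) hβt
    rw [base_comp, base_comp, show Base F β = 𝟙 _ from hβ.1, Category.id_comp] at e
    exact (cancel_epi (Base F h)).mp (e.trans (Category.comp_id _).symm)
  have hβt_lin : IsLinear F βt := by
    have e := congrArg (degFr F) hβt
    rw [degFr_comp, degFr_comp, show degFr F β = 1 from hβ.2, one_mul] at e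
    exact mul_left_cancel (e.trans (mul_one _).symm)
  -- E3: split in `A'`
  obtain ⟨⟨u', t'⟩, hsplit⟩ := τ.splitMap_surjective hF hA' ⟨βt, hβt_base, hβt_lin⟩
  have hsplit' : (t'.1 : A' ⟶ A') ≫ u'.1.hom = βt := congrArg Subtype.val hsplit
  -- E4: pull the `τ`-component back along the hull
  obtain ⟨β₁, hβ₁mem, hβ₁⟩ := τ.hull h hh t'.1 t'.2
  -- E5: the unit, by faithfulness up to units
  have hdivβ : Div F β = Div F β₁ := by
    rw [div_eq_pull_of_transport hhiso hhpre.1 hβt,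
      div_eq_pull_of_transport hhiso hhpre.1 hβ₁, ← hsplit', div_comp_unit hP]
  obtain ⟨u, hu, hfac⟩ := hF.vi β β₁
    ⟨isCoAngular_endo F hF _, isPreStep_of_mem_endSubmonoid F ⟨β, hβ⟩⟩
    ⟨isCoAngular_endo F hF _, isPreStep_of_mem_endSubmonoid F ⟨β₁, hβ₁mem⟩⟩
    (hβ.1.trans hβ₁mem.1.symm) hdivβ
  refine ⟨(u, β₁), ⟨hu, hβ₁mem, ⟨t'.1, t'.2, hβ₁⟩, hfac.symm⟩, ?_⟩
  -- uniqueness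
  rintro ⟨u₂, b₂⟩ ⟨hu₂, hb₂, ⟨t₂, ht₂, hht₂⟩, hβ₂⟩
  have hdiv₂ : Div F b₂ = Div F β₁ := by
    rw [← div_comp_unit hP b₂ u₂, ← hβ₂, hdivβ]
  have hdt : Div F t₂ = Div F (t'.1 : A' ⟶ A') := by
    apply pull_injective_of_isIso Φ (Base F h)
    rw [← div_eq_pull_of_transport hhiso hhpre.1 hht₂,
      ← div_eq_pull_of_transport hhiso hhpre.1 hβ₁, hdiv₂]
  have ht : t₂ = t'.1 := tau_eq_of_div_eq hF τ hA' ht₂ t'.2 hdt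
  have hb : b₂ = β₁ := by
    haveI := hF.v_a h hhpre
    apply (cancel_mono h).mp
    rw [← hht₂, ht, hβ₁]
  subst hb
  have hu' : u₂ = u := by
    haveI := hP.isTotallyEpimorphic.epi b₂
    apply Iso.ext
    exact (cancel_epi b₂).mp (hβ₂.symm.trans hfac.symm)
  rw [hu']

end FrdI.P25

end Literature.AlgebraicGeometry.Frobenioids
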